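import Summits.ValiantsHypothesis.ValiantsHypothesis.Theorems.DivisionGapSquareGridDimersDivisionEasyRenewal

/-!
# Propp's weight-sum algorithm for weighted Aztec diamonds

The inner vertices of the Aztec diamond of order `m + 1` carry a copy of the diamond of order `m`
(`Z_inner_eq_Z_univ`); combined with one shuffling round this is Propp's theorem `propp`, and
iterating it `n` times expresses the dimer partition function of a weighted Aztec diamond of order
`n` whose cell factors never vanish as the product of all the cell factors met (`Z_eq_allCF`;
Propp 2003, §2: "the weighted sum of the matchings of the original graph of order n is just the
product of n² + (n-1)² + ... + 1 terms, read off from the cells").  `Z_eq_allCF` is recorded for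
reference; the closing proof uses the level-indexed form `propp'` (file `…Layers`). [cite: Propp2003, §2]

All `def … : Prop` declarations in this file are decidable predicates on finite data (not named facts).
Support file for `SquareGridDimersDivisionEasy` (route DivisionGap, item stmt-ValiantsHypothesis-5072);
the closing theorem is `squareGridDimersDivisionEasy_proof` in `…DivisionGapSquareGridDimersDivisionEasy.lean`.
-/

namespace Summit.ValiantsHypothesis.ValiantsHypothesis.Theorems

namespace SquareGridDimers

set_option linter.dupNamespace false

noncomputable section

open Finset

/-! ## Re-indexing: the inner vertices of `A_{m+1}` form a copy of `A_m` -/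

/-- The edge of `A_{m+1}` corresponding to an edge of `A_m` under the identification of `A_m` with
the inner part of `A_{m+1}` (same geometric edge; the roles of the two corner types swap and the
level-`(m+1)` cell containing it is `(p'+δ', q'+ε')`, where it sits in the opposite position).
[cite: Propp2003, §5] -/
def ι {m : ℕ} (e : E m) : E (m + 1) :=
  ((⟨e.1.1.val + e.2.1.val, by omega⟩, ⟨e.1.2.val + e.2.2.val, by omega⟩), (e.2.1.rev, e.2.2.rev))

/-- The vertex of `A_{m+1}` corresponding to a vertex of `A_m`. [cite: Propp2003, §5] -/
def jv {m : ℕ} : V m → V (m + 1)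
  | Sum.inl (x, y) => Sum.inr (⟨x.val, by omega⟩, ⟨y.val + 1, by omega⟩)
  | Sum.inr (p, y) => Sum.inl (⟨p.val + 1, by omega⟩, ⟨y.val, by omega⟩)

/-- `ι` is injective. [folklore] -/
theorem ι_injective (m : ℕ) : Function.Injective (ι (m := m)) := by
  rintro ⟨⟨p, q⟩, ⟨δ, ε⟩⟩ ⟨⟨p', q'⟩, ⟨δ', ε'⟩⟩ h
  simp only [ι, Prod.mk.injEq, Fin.mk.injEq, Fin.rev_inj] at h
  obtain ⟨⟨h1, h2⟩, rfl, rfl⟩ := h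
  simp only [Prod.mk.injEq, and_true]
  exact ⟨Fin.ext (by omega), Fin.ext (by omega)⟩

/-- `jv` is injective. [folklore] -/
theorem jv_injective (m : ℕ) : Function.Injective (jv (m := m)) := by
  rintro (⟨x, y⟩ | ⟨p, y⟩) (⟨x', y'⟩ | ⟨p', y''⟩) h <;>
    simp only [jv, Sum.inl.injEq, Sum.inr.injEq, Prod.mk.injEq, Fin.mk.injEq, reduceCtorEq] at h
  · obtain ⟨h1, h2⟩ := h; congr 2 <;> ext <;> omega
  · obtain ⟨h1, h2⟩ := h; congr 2 <;> ext <;> omega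

/-- The horizontal endpoint of `ι e` is the (image of the) vertical endpoint of `e`. [folklore] -/
theorem hEnd_ι {m : ℕ} (e : E m) : hEnd (ι e) = jv (vEnd e) := by
  obtain ⟨⟨p, q⟩, ⟨δ, ε⟩⟩ := e
  have hδ := δ.isLt
  simp only [hEnd, ι, vEnd, jv, Sum.inl.injEq, Prod.mk.injEq, Fin.ext_iff, Fin.val_rev, and_true]
  omega

/-- The vertical endpoint of `ι e` is the (image of the) horizontal endpoint of `e`. [folklore] -/
theorem vEnd_ι {m : ℕ} (e : E m) : vEnd (ι e) = jv (hEnd e) := by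
  obtain ⟨⟨p, q⟩, ⟨δ, ε⟩⟩ := e
  have hε := ε.isLt
  simp only [hEnd, ι, vEnd, jv, Sum.inr.injEq, Prod.mk.injEq, Fin.ext_iff, Fin.val_rev, true_and]
  omega

/-- Incidence is transported by `ι` / `jv`. [folklore] -/
theorem inc_ι_jv {m : ℕ} (e : E m) (v : V m) : Inc (ι e) (jv v) ↔ Inc e v := by
  simp only [Inc, hEnd_ι, vEnd_ι, (jv_injective m).eq_iff]
  exact or_comm

/-- The image of `jv` is the set of inner vertices. [folklore] -/
theorem isInner_iff_exists {m : ℕ} (v : V (m + 1)) : IsInner v ↔ ∃ w, jv w = v := by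
  constructor
  · intro h
    rcases v with ⟨x, y⟩ | ⟨p, y⟩
    · simp only [IsInner] at h
      refine ⟨Sum.inr (⟨x.val - 1, by omega⟩, ⟨y.val, by omega⟩), ?_⟩
      simp only [jv, Sum.inl.injEq, Prod.mk.injEq, Fin.ext_iff, and_true]
      omega
    · simp only [IsInner] at h
      refine ⟨Sum.inl (⟨p.val, by omega⟩, ⟨y.val - 1, by omega⟩), ?_⟩
      simp only [jv, Sum.inr.injEq, Prod.mk.injEq, Fin.ext_iff, true_and]
      omega
  · rintro ⟨w, rfl⟩
    rcases w with ⟨x, y⟩ | ⟨p, y⟩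
    · simp only [jv, IsInner]; have := y.isLt; omega
    · simp only [jv, IsInner]; have := p.isLt; omega

/-- An edge of the form `ι e` has inner endpoints only. [folklore] -/
theorem isInner_of_inc_ι {m : ℕ} (e : E m) (v : V (m + 1)) (h : Inc (ι e) v) : IsInner v := by
  rw [isInner_iff_exists]
  rcases h with h | h
  · exact ⟨_, (hEnd_ι e).symm.trans h⟩
  · exact ⟨_, (vEnd_ι e).symm.trans h⟩

/-- An edge of `A_{m+1}` with inner endpoints comes from `A_m`. [folklore] -/
theorem exists_ι_eq {m : ℕ} (e : E (m + 1)) (h1 : IsInner (hEnd e)) (h2 : IsInner (vEnd e)) :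
    ∃ e', ι e' = e := by
  obtain ⟨⟨p, q⟩, ⟨δ, ε⟩⟩ := e
  simp only [hEnd, vEnd, IsInner] at h1 h2
  refine ⟨((⟨p.val + δ.val - 1, by omega⟩, ⟨q.val + ε.val - 1, by omega⟩), (δ.rev, ε.rev)), ?_⟩
  simp only [ι, Fin.rev_rev, Fin.val_rev, Prod.mk.injEq, Fin.ext_iff, and_true]
  constructor <;> omega

/-- Degrees are transported by `ι` / `jv`. [folklore] -/
theorem deg_map_ι_jv {m : ℕ} (M : Finset (E m)) (v : V m) :
    deg (M.map ⟨ι, ι_injective m⟩) (jv v) = deg M v := by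
  classical
  unfold deg
  rw [filter_map, card_map]
  congr 1
  ext e
  simp only [mem_filter, Function.comp_apply, Function.Embedding.coeFn_mk, inc_ι_jv]

/-- Outside the inner vertices an edge set coming from `A_m` has degree zero. [folklore] -/
theorem deg_map_ι_of_not_isInner {m : ℕ} (M : Finset (E m)) (v : V (m + 1)) (hv : ¬ IsInner v) :
    deg (M.map ⟨ι, ι_injective m⟩) v = 0 := by
  classical
  unfold deg
  rw [card_eq_zero, filter_eq_empty_iff]
  intro e he hinc
  rw [mem_map] at he
  obtain ⟨e', _, rfl⟩ := he
  exact hv (isInner_of_inc_ι e' v hinc)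

/-- Perfect matchings of `A_m` are the perfect matchings of the inner part of `A_{m+1}`. [folklore] -/
theorem isPM_map_ι_iff {m : ℕ} (M : Finset (E m)) :
    IsPM (inner m) (M.map ⟨ι, ι_injective m⟩) ↔ IsPM univ M := by
  constructor
  · intro h v
    have := h (jv v)
    rw [deg_map_ι_jv] at this
    rw [this]
    simp [(isInner_iff_exists (jv v)).mpr ⟨v, rfl⟩]
  · intro h v
    by_cases hv : IsInner v
    · obtain ⟨w, rfl⟩ := (isInner_iff_exists v).mp hv
      rw [deg_map_ι_jv, h w]
      simp [hv]
    · rw [deg_map_ι_of_not_isInner M v hv]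
      simp [hv]

/-- The endpoints of the edges of a perfect matching of `U` lie in `U`. [folklore] -/
theorem mem_of_isPM {m : ℕ} {U : Finset (V m)} {M : Finset (E m)} (hM : IsPM U M) {e : E m}
    (he : e ∈ M) : hEnd e ∈ U ∧ vEnd e ∈ U := by
  classical
  have key : ∀ v, Inc e v → v ∈ U := by
    intro v hv
    by_contra hvU
    have h0 : deg M v = 0 := by rw [hM v, if_neg hvU]
    unfold deg at h0
    rw [card_eq_zero, filter_eq_empty_iff] at h0
    exact h0 he hv
  exact ⟨key _ (Or.inl rfl), key _ (Or.inr rfl)⟩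

/-- **Re-indexing.** The partition function of the inner part of `A_{m+1}` is the partition
function of `A_m` with the transported weights. [cite: Propp2003, §5] -/
theorem Z_inner_eq_Z_univ {m : ℕ} {F : Type*} [CommSemiring F] (ew : E (m + 1) → F) :
    Z (inner m) ew = Z (univ : Finset (V m)) (fun e => ew (ι e)) := by
  classical
  unfold Z
  symm
  refine sum_bij' (fun M _ => M.map ⟨ι, ι_injective m⟩)
    (fun M _ => M.preimage ι ((ι_injective m).injOn)) ?_ ?_ ?_ ?_ ?_
  · intro M hM
    rw [mem_pmSet] at hM ⊢
    exact (isPM_map_ι_iff M).mpr hM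
  · intro M hM
    rw [mem_pmSet] at hM ⊢
    rw [← isPM_map_ι_iff]
    convert hM using 1
    rw [map_eq_image]
    simp only [Function.Embedding.coeFn_mk]
    rw [image_preimage]
    refine filter_true_of_mem fun e he => ?_
    obtain ⟨h1, h2⟩ := mem_of_isPM hM he
    rw [mem_inner] at h1 h2
    obtain ⟨e', rfl⟩ := exists_ι_eq e h1 h2
    exact Set.mem_range_self e'
  · intro M _
    ext e
    simp only [mem_preimage, mem_map, Function.Embedding.coeFn_mk]
    constructor
    · rintro ⟨e', he', h⟩; rwa [← ι_injective m h]
    · intro he; exact ⟨e, he, rfl⟩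
  · intro M hM
    rw [mem_pmSet] at hM
    rw [map_eq_image]
    simp only [Function.Embedding.coeFn_mk]
    rw [image_preimage]
    refine filter_true_of_mem fun e he => ?_
    obtain ⟨h1, h2⟩ := mem_of_isPM hM he
    rw [mem_inner] at h1 h2
    obtain ⟨e', rfl⟩ := exists_ι_eq e h1 h2
    exact Set.mem_range_self e'
  · intro M _
    rw [prod_map]
    rfl

/-! ## Propp's theorem and its iteration: the weight sum is the product of all cell factors -/

/-- Level-free edge indices: a cell `(p, q) ∈ ℕ × ℕ` and a position. [cite: Propp2003, §2] -/
abbrev EInf : Type := (ℕ × ℕ) × Pos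

/-- The level-free index of an edge of `A_m`. [folklore] -/
def emb {m : ℕ} (e : E m) : EInf := ((e.1.1.val, e.1.2.val), e.2)

/-- Level-free cell factor. [cite: Propp2003, §2] -/
def cfInf {F : Type*} [CommSemiring F] (W : EInf → F) (c : ℕ × ℕ) : F :=
  W (c, (0, 1)) * W (c, (1, 0)) + W (c, (1, 1)) * W (c, (0, 0))

/-- Level-free renewal step of the generalized domino-shuffling weight algorithm: the weights of the
Aztec diamond of the next lower order, indexed by its own cells (Propp 2003, §2: replace each cell's
weights `w, x, y, z` by `z, y, x, w` over `wz + xy`, and strip the outer flank). [cite: Propp2003, §2] -/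
def renewInf {F : Type*} [Field F] (W : EInf → F) (e : EInf) : F :=
  W ((e.1.1 + e.2.1.val, e.1.2 + e.2.2.val), e.2) / cfInf W (e.1.1 + e.2.1.val, e.1.2 + e.2.2.val)

/-- Compatibility of the cell factors. [folklore] -/
theorem cf_comp_emb {m : ℕ} {F : Type*} [CommSemiring F] (W : EInf → F) (c : Cell m) :
    cf (fun e : E m => W (emb e)) c = cfInf W (c.1.val, c.2.val) := by
  simp [cf, cfInf, emb]

/-- Compatibility of the renewal steps. [folklore] -/
theorem rt_ι_eq_renewInf {m : ℕ} {F : Type*} [Field F] (W : EInf → F) (e : E m) :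
    rt (fun e' : E (m + 1) => W (emb e')) (ι e) = renewInf W (emb e) := by
  obtain ⟨⟨p, q⟩, ⟨δ, ε⟩⟩ := e
  simp only [rt, renewInf, cf_comp_emb]
  simp [emb, ι, opp, Fin.rev_rev]

/-- **Propp's theorem** (generalized domino shuffling, weight-sum version): if no cell factor of the
weighted Aztec diamond of order `m + 1` vanishes, its dimer partition function is the product of the
cell factors times the partition function of the order-`m` diamond with the renewed weights.
[cite: Propp2003, §2 and §5] -/
theorem propp {m : ℕ} {F : Type*} [Field F] (W : EInf → F)
    (hcf : ∀ c : Cell (m + 1), cfInf W (c.1.val, c.2.val) ≠ 0) :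
    Z (univ : Finset (V (m + 1))) (fun e => W (emb e)) =
      (∏ c : Cell (m + 1), cfInf W (c.1.val, c.2.val)) *
        Z (univ : Finset (V m)) (fun e => renewInf W (emb e)) := by
  rw [Z_univ_eq_prod_cf_mul_Z_inner _ (fun c => by rw [cf_comp_emb]; exact hcf c), Z_inner_eq_Z_univ]
  simp only [cf_comp_emb, rt_ι_eq_renewInf]

/-- The empty Aztec diamond has partition function `1`. [folklore] -/
theorem Z_univ_zero {F : Type*} [CommSemiring F] (ew : E 0 → F) : Z (univ : Finset (V 0)) ew = 1 := by
  have hE : ∀ M : Finset (E 0), M = ∅ := fun M => by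
    ext ⟨⟨p, _⟩, _⟩; exact p.elim0
  have hpm : pmSet (univ : Finset (V 0)) = {∅} := by
    ext M
    rw [mem_pmSet, mem_singleton, hE M]
    simp only [iff_true]
    intro v
    rcases v with ⟨_, y⟩ | ⟨p, _⟩
    · exact y.elim0
    · exact p.elim0
  rw [Z, hpm, sum_singleton, prod_empty]

/-- The product of all the cell factors met by the algorithm run for `n` rounds from the weights
`W` of an order-`n` Aztec diamond. [cite: Propp2003, §2] -/
def allCF {F : Type*} [Field F] (W : EInf → F) (n : ℕ) : F :=
  ∏ d ∈ range n, ∏ p ∈ range (n - d), ∏ q ∈ range (n - d), cfInf (renewInf^[d] W) (p, q)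

/-- A product over the cells of level `k` as a product over `range k × range k`. [folklore] -/
theorem prod_cell_eq {F : Type*} [CommMonoid F] (k : ℕ) (g : ℕ × ℕ → F) :
    ∏ c : Cell k, g (c.1.val, c.2.val) = ∏ p ∈ range k, ∏ q ∈ range k, g (p, q) := by
  rw [Fintype.prod_prod_type]
  change ∏ x : Fin k, ∏ y : Fin k, g (x.val, y.val) = _
  rw [← Fin.prod_univ_eq_prod_range (fun p => ∏ q ∈ range k, g (p, q)) k]
  refine Fintype.prod_congr _ _ fun p => ?_
  rw [← Fin.prod_univ_eq_prod_range (fun q => g (p, q)) k]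

/-- **The weight-sum algorithm** (Propp 2003, §2): if no cell factor met along the way vanishes,
the dimer partition function of a weighted Aztec diamond of order `n` is the product of the
`n² + (n-1)² + ⋯ + 1` cell factors. [cite: Propp2003, §2] -/
theorem Z_eq_allCF {F : Type*} [Field F] (n : ℕ) :
    ∀ W : EInf → F, (∀ d < n, ∀ p < n - d, ∀ q < n - d, cfInf (renewInf^[d] W) (p, q) ≠ 0) →
      Z (univ : Finset (V n)) (fun e => W (emb e)) = allCF W n := by
  induction n with
  | zero => intro W _; rw [Z_univ_zero]; simp [allCF]
  | succ n ih =>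
    intro W hW
    rw [propp W (fun c => by
      have := hW 0 (by omega) c.1.val (by have := c.1.isLt; omega) c.2.val
        (by have := c.2.isLt; omega)
      simpa using this)]
    rw [ih (renewInf W) (fun d hd p hp q hq => by
      have := hW (d + 1) (by omega) p (by omega) q (by omega)
      rwa [Function.iterate_succ_apply] at this)]
    rw [allCF, allCF, prod_range_succ', mul_comm]
    congr 1
    · refine prod_congr rfl fun d _ => ?_
      rw [Nat.add_sub_add_right, Function.iterate_succ_apply]
    · simp only [Nat.sub_zero, Function.iterate_zero, id_eq]
      exact prod_cell_eq (n + 1) (cfInf W)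

end

end SquareGridDimers

end Summit.ValiantsHypothesis.ValiantsHypothesis.Theorems
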